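import Mathlib
import Literature.Geometry.DiscreteGeometry.KissingPatterns
import Summits.AtomisticToContinuum.Crystallization.Theorems.PalmUnimodularRigidityShellsToBarlowChartCharts
import Summits.AtomisticToContinuum.Crystallization.Theorems.PalmUnimodularRigidityShellsToBarlowChartTransportSteps1

/-!
# `CleanLimitsHaveWindows` (stmt-AtomisticToContinuum-15932), line `Sketch` — helper for stub K1
# (`stub_cleanChart`): the chart TRANSFER lemma at matching radius `1/5`, part 1 (links)

Stub K1 (clean, torn-free `Z` ⇒ bond graph ≅ octet truss of a Barlow stacking) is proved by re-running
the development of the crux `ShellsToBarlowChart` (route `PalmUnimodularRigidity`, files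
`PalmUnimodularRigidityShellsToBarlowChart*`), whose ONLY metric input is the transfer lemma
`sqNormInt_transfer` (file `…Charts`): across a bond `x ~ y`, the squared integer label distance of two
common neighbours read in the chart at `y` equals the one read at `x`.  There it is proved from the
`1 %` matching by the gaps of the label spectrum.  Here the matching radius is `1/5` (of the bond
length `b`), far too coarse for a spectrum argument (two readings differ by up to `4b/5`), and the
transfer is proved combinatorially + by ONE rigid-motion-free identity:

* the links of the two charts over the bond are isomorphic as graphs (bonds are physical), so the
  in-link degrees of corresponding labels agree (`deg_transfer`);
* in a link with an isolated label (equatorial hcp sites, vertex figure `3.3.4.4`) all label distances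
  are determined by the degrees (pattern fact `linkII_table`, `decide`);
* in a link that is a perfect matching (vertex figure `3.4.3.4`) the two non-neighbours of a label are
  at squared distances `36` (across a square) and `54`; if the square partner at `x` were the far
  partner at `y`, the two matched pairs would give unit vectors `U, U'` (differences of ideal positions,
  pattern fact `linkI_vec`) with `‖U − U'‖, ‖U + U'‖ ≤ 4b/5`, contradicting the parallelogram law
  `‖U − U'‖² + ‖U + U'‖² = 4b²` (`parallelogram_obstruction`).

Charts are taken in the integer form of `…TransportDefs.IsZChart` but with closeness `b/5` at a common
scale `b` and no scale window (spelled out inline; no new definitions).  This part: the pattern facts,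
the parallelogram obstruction, and the combinatorial bookkeeping of two charts across a bond (degree
transfer, correspondence of links); part 2 (`…CleanChartTransfer`) concludes.
-/

noncomputable section

namespace Summit.AtomisticToContinuum.Crystallization.Theorems.CleanHull

open Literature.Geometry.DiscreteGeometry
open Summit.AtomisticToContinuum.Crystallization.Theorems.PalmUnimodularRigidityShellsToBarlowChart

/-! ## Pattern facts about links (integer arithmetic, `decide`) -/

/-- Non-adjacent distinct labels of a link are at squared distance `36`, `48` or `54`. [folklore] -/
theorem link_spectrum : ∀ Q : Finset (Fin 3 → ℤ), (Q = fcc3Int ∨ Q = hcpInt) →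
    ∀ c ∈ Q, ∀ τ ∈ (Finset.filter (fun τ : Fin 3 → ℤ => sqNormInt (τ - c) = 18) Q), ∀ τ' ∈ (Finset.filter (fun τ : Fin 3 → ℤ => sqNormInt (τ - c) = 18) Q), τ ≠ τ' → sqNormInt (τ - τ') ≠ 18 →
      (sqNormInt (τ - τ') = 36 ∨ sqNormInt (τ - τ') = 48 ∨ sqNormInt (τ - τ') = 54) := by
  rintro Q (rfl | rfl) <;> decide

/-- A link is a perfect matching (all in-link degrees `1`: vertex figure `3.4.3.4`) or has an
isolated label (vertex figure `3.3.4.4`, equatorial hcp labels). [folklore] -/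
theorem link_dichotomy : ∀ Q : Finset (Fin 3 → ℤ), (Q = fcc3Int ∨ Q = hcpInt) →
    ∀ c ∈ Q, (∀ τ ∈ (Finset.filter (fun τ : Fin 3 → ℤ => sqNormInt (τ - c) = 18) Q), (Finset.filter (fun τ₂ : Fin 3 → ℤ => sqNormInt (τ - τ₂) = 18) (Finset.filter (fun σ : Fin 3 → ℤ => sqNormInt (σ - c) = 18) Q)).card = 1) ∨ (∃ τ ∈ (Finset.filter (fun τ : Fin 3 → ℤ => sqNormInt (τ - c) = 18) Q), (Finset.filter (fun τ₂ : Fin 3 → ℤ => sqNormInt (τ - τ₂) = 18) (Finset.filter (fun σ : Fin 3 → ℤ => sqNormInt (σ - c) = 18) Q)).card = 0) := by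
  rintro Q (rfl | rfl) <;> decide

/-- In a link with an isolated label all label distances are determined by the in-link degrees.
[folklore] -/
theorem linkII_table : ∀ Q : Finset (Fin 3 → ℤ), (Q = fcc3Int ∨ Q = hcpInt) →
    ∀ c ∈ Q, (∃ τ₀ ∈ (Finset.filter (fun τ : Fin 3 → ℤ => sqNormInt (τ - c) = 18) Q), (Finset.filter (fun τ₂ : Fin 3 → ℤ => sqNormInt (τ₀ - τ₂) = 18) (Finset.filter (fun σ : Fin 3 → ℤ => sqNormInt (σ - c) = 18) Q)).card = 0) → ∀ τ ∈ (Finset.filter (fun τ : Fin 3 → ℤ => sqNormInt (τ - c) = 18) Q), ∀ τ' ∈ (Finset.filter (fun τ : Fin 3 → ℤ => sqNormInt (τ - c) = 18) Q), τ ≠ τ' →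
      sqNormInt (τ - τ') ≠ 18 →
      sqNormInt (τ - τ') = (if (Finset.filter (fun τ₂ : Fin 3 → ℤ => sqNormInt (τ - τ₂) = 18) (Finset.filter (fun σ : Fin 3 → ℤ => sqNormInt (σ - c) = 18) Q)).card = 0 ∨ (Finset.filter (fun τ₂ : Fin 3 → ℤ => sqNormInt (τ' - τ₂) = 18) (Finset.filter (fun σ : Fin 3 → ℤ => sqNormInt (σ - c) = 18) Q)).card = 0 then
        (if (Finset.filter (fun τ₂ : Fin 3 → ℤ => sqNormInt (τ - τ₂) = 18) (Finset.filter (fun σ : Fin 3 → ℤ => sqNormInt (σ - c) = 18) Q)).card = 2 ∨ (Finset.filter (fun τ₂ : Fin 3 → ℤ => sqNormInt (τ' - τ₂) = 18) (Finset.filter (fun σ : Fin 3 → ℤ => sqNormInt (σ - c) = 18) Q)).card = 2 then 54 else 36) else 48) := by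
  rintro Q (rfl | rfl) <;> decide

/-- In a perfect-matching link no two labels are at squared distance `48`. [folklore] -/
theorem linkI_ne_48 : ∀ Q : Finset (Fin 3 → ℤ), (Q = fcc3Int ∨ Q = hcpInt) →
    ∀ c ∈ Q, (∀ τ ∈ (Finset.filter (fun τ : Fin 3 → ℤ => sqNormInt (τ - c) = 18) Q), (Finset.filter (fun τ₂ : Fin 3 → ℤ => sqNormInt (τ - τ₂) = 18) (Finset.filter (fun σ : Fin 3 → ℤ => sqNormInt (σ - c) = 18) Q)).card = 1) → ∀ τ ∈ (Finset.filter (fun τ : Fin 3 → ℤ => sqNormInt (τ - c) = 18) Q), ∀ τ' ∈ (Finset.filter (fun τ : Fin 3 → ℤ => sqNormInt (τ - c) = 18) Q),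
      sqNormInt (τ - τ') ≠ 48 := by
  rintro Q (rfl | rfl) <;> decide

/-- In a perfect-matching link: if `τ₂ ~ τ₁`, `τ₄ ~ τ₃` and `τ₂, τ₃` are across a square (`36`), then
`τ₂ − τ₁ = τ₃ − τ₄` (opposite sides of the `1 × √2` rectangle). [folklore] -/
theorem linkI_vec : ∀ Q : Finset (Fin 3 → ℤ), (Q = fcc3Int ∨ Q = hcpInt) →
    ∀ c ∈ Q, (∀ τ ∈ (Finset.filter (fun τ : Fin 3 → ℤ => sqNormInt (τ - c) = 18) Q), (Finset.filter (fun τ₂ : Fin 3 → ℤ => sqNormInt (τ - τ₂) = 18) (Finset.filter (fun σ : Fin 3 → ℤ => sqNormInt (σ - c) = 18) Q)).card = 1) →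
      ∀ τ₁ ∈ (Finset.filter (fun τ : Fin 3 → ℤ => sqNormInt (τ - c) = 18) Q), ∀ τ₂ ∈ (Finset.filter (fun τ : Fin 3 → ℤ => sqNormInt (τ - c) = 18) Q), ∀ τ₃ ∈ (Finset.filter (fun τ : Fin 3 → ℤ => sqNormInt (τ - c) = 18) Q), ∀ τ₄ ∈ (Finset.filter (fun τ : Fin 3 → ℤ => sqNormInt (τ - c) = 18) Q),
      sqNormInt (τ₂ - τ₁) = 18 → sqNormInt (τ₄ - τ₃) = 18 → sqNormInt (τ₂ - τ₃) = 36 →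
        τ₂ - τ₁ = τ₃ - τ₄ := by
  rintro Q (rfl | rfl) <;> decide

/-- In a perfect-matching link the two non-neighbours of a label are at squared distances `54` and
`36`. [folklore] -/
theorem linkI_36_of_54 : ∀ Q : Finset (Fin 3 → ℤ), (Q = fcc3Int ∨ Q = hcpInt) →
    ∀ c ∈ Q, (∀ τ ∈ (Finset.filter (fun τ : Fin 3 → ℤ => sqNormInt (τ - c) = 18) Q), (Finset.filter (fun τ₂ : Fin 3 → ℤ => sqNormInt (τ - τ₂) = 18) (Finset.filter (fun σ : Fin 3 → ℤ => sqNormInt (σ - c) = 18) Q)).card = 1) → ∀ τ ∈ (Finset.filter (fun τ : Fin 3 → ℤ => sqNormInt (τ - c) = 18) Q), ∀ τ' ∈ (Finset.filter (fun τ : Fin 3 → ℤ => sqNormInt (τ - c) = 18) Q), ∀ τ'' ∈ (Finset.filter (fun τ : Fin 3 → ℤ => sqNormInt (τ - c) = 18) Q),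
      sqNormInt (τ - τ') = 54 → τ'' ≠ τ → τ'' ≠ τ' → sqNormInt (τ - τ'') ≠ 18 →
        sqNormInt (τ - τ'') = 36 := by
  rintro Q (rfl | rfl) <;> decide

/-- Labels of either integer pattern have squared norm `18`. [folklore] -/
theorem sqNormInt_label {Q : Finset (Fin 3 → ℤ)} (hQ : Q = fcc3Int ∨ Q = hcpInt) {t : Fin 3 → ℤ}
    (ht : t ∈ Q) : sqNormInt t = 18 := by
  rcases hQ with rfl | rfl
  · exact sqNormInt_of_mem_fcc3Int t ht
  · exact sqNormInt_of_mem_hcpInt t ht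

/-! ## The parallelogram obstruction -/

/-- Two vectors of the same length `b > 0` cannot have both their sum and their difference of length
`≤ 4b/5` (parallelogram law: `‖U + U'‖² + ‖U − U'‖² = 4 b²`). [folklore] -/
theorem parallelogram_obstruction {U U' : EuclideanSpace ℝ (Fin 3)} {b : ℝ} (hb : 0 < b) (hU : ‖U‖ = b) (hU' : ‖U'‖ = b)
    (h1 : ‖U - U'‖ ≤ 4 / 5 * b) (h2 : ‖U + U'‖ ≤ 4 / 5 * b) : False := by
  have key := parallelogram_law_with_norm ℝ U U'
  rw [hU, hU'] at key
  nlinarith [norm_nonneg (U - U'), norm_nonneg (U + U'), mul_le_mul h1 h1 (norm_nonneg _) (by positivity),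
    mul_le_mul h2 h2 (norm_nonneg _) (by positivity)]

/-- The ideal position difference of two touching labels has length exactly `b`. [folklore] -/
theorem norm_ideal_sub {b : ℝ} (hb : 0 ≤ b) (x : (EuclideanSpace ℝ (Fin 3))) (A : (EuclideanSpace ℝ (Fin 3)) →ₗᵢ[ℝ] (EuclideanSpace ℝ (Fin 3))) {t t' : Fin 3 → ℤ}
    (h : sqNormInt (t - t') = 18) :
    ‖(x + (b * (Real.sqrt 18)⁻¹) • A (intVec t)) - (x + (b * (Real.sqrt 18)⁻¹) • A (intVec t'))‖ = b := by
  rw [← dist_eq_norm, dist_ideal hb, h]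
  push_cast
  rw [mul_assoc, inv_mul_cancel₀ (by positivity), mul_one]

/-- The ideal position difference depends only on the label difference. [folklore] -/
theorem ideal_sub_eq {b : ℝ} (x : (EuclideanSpace ℝ (Fin 3))) (A : (EuclideanSpace ℝ (Fin 3)) →ₗᵢ[ℝ] (EuclideanSpace ℝ (Fin 3))) {t₁ t₂ t₃ t₄ : Fin 3 → ℤ}
    (h : t₂ - t₁ = t₃ - t₄) :
    (x + (b * (Real.sqrt 18)⁻¹) • A (intVec t₂)) - (x + (b * (Real.sqrt 18)⁻¹) • A (intVec t₁)) =
      (x + (b * (Real.sqrt 18)⁻¹) • A (intVec t₃)) - (x + (b * (Real.sqrt 18)⁻¹) • A (intVec t₄)) := by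
  rw [add_sub_add_left_eq_sub, add_sub_add_left_eq_sub, ← smul_sub, ← smul_sub, ← map_sub, ← map_sub,
    intVec_sub, intVec_sub, h]

/-! ## Charts at matching radius `b/5`: bookkeeping -/

section Charts

variable {S : Set (EuclideanSpace ℝ (Fin 3))} {b : ℝ} {x y : (EuclideanSpace ℝ (Fin 3))} {P P' : Finset (Fin 3 → ℤ)} {A A' : (EuclideanSpace ℝ (Fin 3)) →ₗᵢ[ℝ] (EuclideanSpace ℝ (Fin 3))}
  {nbx nby : (Fin 3 → ℤ) → (EuclideanSpace ℝ (Fin 3))}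

/-- **Degree transfer.** Across a bond `x ~ y` with charts at both ends (`y = nbx t_y`,
`x = nby u_x`), a label `τ` of the link of `t_y` at `x` and the label `μ` at `y` of the same point have
the same in-link degree: both count the points of `S` bonded to `x`, `y` and that point. [folklore] -/
theorem deg_transfer
    (hbijx : Set.BijOn nbx ↑P {z | z ∈ S ∧ (0 < dist x z ∧ dist x z ≤ 28 / 25)})
    (hbdx : ∀ t ∈ P, ∀ t' ∈ P, ((0 < dist (nbx t) (nbx t') ∧ dist (nbx t) (nbx t') ≤ 28 / 25) ↔
      sqNormInt (t - t') = 18))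
    (hbijy : Set.BijOn nby ↑P' {z | z ∈ S ∧ (0 < dist y z ∧ dist y z ≤ 28 / 25)})
    (hbdy : ∀ u ∈ P', ∀ u' ∈ P', ((0 < dist (nby u) (nby u') ∧ dist (nby u) (nby u') ≤ 28 / 25) ↔
      sqNormInt (u - u') = 18))
    {ty ux τ μ : Fin 3 → ℤ} (hty : ty ∈ P) (htyy : nbx ty = y) (hux : ux ∈ P') (huxx : nby ux = x)
    (hτ : τ ∈ P) (hμ : μ ∈ P') (hμτ : nby μ = nbx τ) :
    (Finset.filter (fun τ₂ : Fin 3 → ℤ => sqNormInt (τ - τ₂) = 18) (Finset.filter (fun σ : Fin 3 → ℤ => sqNormInt (σ - ty) = 18) P)).card = (Finset.filter (fun τ₂ : Fin 3 → ℤ => sqNormInt (μ - τ₂) = 18) (Finset.filter (fun σ : Fin 3 → ℤ => sqNormInt (σ - ux) = 18) P')).card := by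
  classical
  -- the common description
  set C : Set (EuclideanSpace ℝ (Fin 3)) := {z | z ∈ S ∧ (0 < dist x z ∧ dist x z ≤ 28 / 25) ∧ (0 < dist y z ∧ dist y z ≤ 28 / 25) ∧
    (0 < dist (nbx τ) z ∧ dist (nbx τ) z ≤ 28 / 25)} with hC
  have hX : nbx '' ↑(Finset.filter (fun τ₂ : Fin 3 → ℤ => sqNormInt (τ - τ₂) = 18)
      (Finset.filter (fun σ : Fin 3 → ℤ => sqNormInt (σ - ty) = 18) P)) = C := by
    ext z
    simp only [Set.mem_image, Finset.mem_coe, Finset.mem_filter]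
    constructor
    · rintro ⟨τ₂, ⟨⟨hτ₂P, hσ⟩, hadj⟩, rfl⟩
      refine ⟨(hbijx.mapsTo hτ₂P).1, (hbijx.mapsTo hτ₂P).2, ?_, (hbdx τ hτ τ₂ hτ₂P).2 hadj⟩
      rw [← htyy]
      exact bond_symm ((hbdx τ₂ hτ₂P ty hty).2 hσ)
    · rintro ⟨hzS, hxz, hyz, hτz⟩
      obtain ⟨τ₂, hτ₂P, rfl⟩ := hbijx.surjOn ⟨hzS, hxz⟩
      refine ⟨τ₂, ⟨⟨hτ₂P, ?_⟩, (hbdx τ hτ τ₂ hτ₂P).1 hτz⟩, rfl⟩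
      rw [← htyy] at hyz
      exact (hbdx τ₂ hτ₂P ty hty).1 (bond_symm hyz)
  have hY : nby '' ↑(Finset.filter (fun τ₂ : Fin 3 → ℤ => sqNormInt (μ - τ₂) = 18)
      (Finset.filter (fun σ : Fin 3 → ℤ => sqNormInt (σ - ux) = 18) P')) = C := by
    ext z
    simp only [Set.mem_image, Finset.mem_coe, Finset.mem_filter]
    constructor
    · rintro ⟨μ₂, ⟨⟨hμ₂P, hσ⟩, hadj⟩, rfl⟩
      refine ⟨(hbijy.mapsTo hμ₂P).1, ?_, (hbijy.mapsTo hμ₂P).2, ?_⟩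
      · rw [← huxx]
        exact bond_symm ((hbdy μ₂ hμ₂P ux hux).2 hσ)
      · rw [← hμτ]
        exact (hbdy μ hμ μ₂ hμ₂P).2 hadj
    · rintro ⟨hzS, hxz, hyz, hτz⟩
      obtain ⟨μ₂, hμ₂P, rfl⟩ := hbijy.surjOn ⟨hzS, hyz⟩
      refine ⟨μ₂, ⟨⟨hμ₂P, ?_⟩, ?_⟩, rfl⟩
      · rw [← huxx] at hxz
        exact (hbdy μ₂ hμ₂P ux hux).1 (bond_symm hxz)
      · rw [← hμτ] at hτz
        exact (hbdy μ hμ μ₂ hμ₂P).1 hτz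
  have h1 := Set.InjOn.ncard_image (hbijx.injOn.mono (fun σ hσ => (Finset.mem_filter.1 (Finset.mem_filter.1 hσ).1).1) :
    Set.InjOn nbx ↑(Finset.filter (fun τ₂ : Fin 3 → ℤ => sqNormInt (τ - τ₂) = 18)
      (Finset.filter (fun σ : Fin 3 → ℤ => sqNormInt (σ - ty) = 18) P)))
  have h2 := Set.InjOn.ncard_image (hbijy.injOn.mono (fun σ hσ => (Finset.mem_filter.1 (Finset.mem_filter.1 hσ).1).1) :
    Set.InjOn nby ↑(Finset.filter (fun τ₂ : Fin 3 → ℤ => sqNormInt (μ - τ₂) = 18)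
      (Finset.filter (fun σ : Fin 3 → ℤ => sqNormInt (σ - ux) = 18) P')))
  rw [Set.ncard_coe_finset] at h1 h2
  rw [← h1, ← h2, hX, hY]

/-- **Correspondence of links.** A label of the link of `t_y` at `x` names a common neighbour of `x` and
`y`, which carries a label at `y`, in the link of `u_x`. [folklore] -/
theorem exists_corr
    (hbijx : Set.BijOn nbx ↑P {z | z ∈ S ∧ (0 < dist x z ∧ dist x z ≤ 28 / 25)})
    (hbdx : ∀ t ∈ P, ∀ t' ∈ P, ((0 < dist (nbx t) (nbx t') ∧ dist (nbx t) (nbx t') ≤ 28 / 25) ↔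
      sqNormInt (t - t') = 18))
    (hbijy : Set.BijOn nby ↑P' {z | z ∈ S ∧ (0 < dist y z ∧ dist y z ≤ 28 / 25)})
    (hbdy : ∀ u ∈ P', ∀ u' ∈ P', ((0 < dist (nby u) (nby u') ∧ dist (nby u) (nby u') ≤ 28 / 25) ↔
      sqNormInt (u - u') = 18))
    {ty ux τ : Fin 3 → ℤ} (hty : ty ∈ P) (htyy : nbx ty = y) (hux : ux ∈ P') (huxx : nby ux = x)
    (hτ : τ ∈ P) (hτty : sqNormInt (τ - ty) = 18) :
    ∃ μ ∈ P', nby μ = nbx τ ∧ sqNormInt (μ - ux) = 18 := by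
  have hb : 0 < dist (nbx τ) (nbx ty) ∧ dist (nbx τ) (nbx ty) ≤ 28 / 25 := (hbdx τ hτ ty hty).2 hτty
  rw [htyy] at hb
  obtain ⟨μ, hμ, hμτ⟩ := hbijy.surjOn ⟨(hbijx.mapsTo hτ).1, bond_symm hb⟩
  refine ⟨μ, hμ, hμτ, (hbdy μ hμ ux hux).1 ?_⟩
  rw [hμτ, huxx]
  exact bond_symm (hbijx.mapsTo hτ).2

/-- Adjacency of labels is physical: corresponding label pairs at `x` and at `y` touch together.
[folklore] -/
theorem adj_transfer
    (hbdx : ∀ t ∈ P, ∀ t' ∈ P, ((0 < dist (nbx t) (nbx t') ∧ dist (nbx t) (nbx t') ≤ 28 / 25) ↔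
      sqNormInt (t - t') = 18))
    (hbdy : ∀ u ∈ P', ∀ u' ∈ P', ((0 < dist (nby u) (nby u') ∧ dist (nby u) (nby u') ≤ 28 / 25) ↔
      sqNormInt (u - u') = 18))
    {τ₁ τ₂ μ₁ μ₂ : Fin 3 → ℤ} (h₁ : τ₁ ∈ P) (h₂ : τ₂ ∈ P) (k₁ : μ₁ ∈ P') (k₂ : μ₂ ∈ P')
    (e₁ : nby μ₁ = nbx τ₁) (e₂ : nby μ₂ = nbx τ₂) :
    sqNormInt (τ₁ - τ₂) = 18 ↔ sqNormInt (μ₁ - μ₂) = 18 := by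
  rw [← hbdx τ₁ h₁ τ₂ h₂, ← hbdy μ₁ k₁ μ₂ k₂, e₁, e₂]

end Charts

end Summit.AtomisticToContinuum.Crystallization.Theorems.CleanHull

end
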